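import Summits.HodgeConjecture.HodgeConjecture.Theorems.LinearSystemTorelliDefs
import Summits.HodgeConjecture.HodgeConjecture.Theses.NodalSupport

/-!
# Route LinearSystemTorelli — crux `MiddleDivisorSupport` (stmt-HodgeConjecture-1081), line
`ch0-null-correspondence-support`: the ∀X ATTACH FRAME `F1 → F2 → F3 → MiddleDivisorSupport`

The registered composition of the line (crux workfile
`Cruxes/MiddleDivisorSupport/Lines/ch0_null_correspondence_support.lean`), landed as a conditional
theorem concluding the crux BY NAME from the three frame statements of the route Defs
(`Theorems/LinearSystemTorelliDefs.lean`, namespace `…Theorems.Ch0Null`):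

* F1 `CorrespondencePackagesExist` — every smooth projective `X^{2p}` carries ONE pinned pair of
  actions of correspondences (Chow action `Act`, Fulton Def. 16.1.2; cohomological action `C`, Voisin II
  (10.7)) with (K1) Bloch–Srinivas for `Act`, (K2) powers, (K3) graphs. CONSTRUCTION DEBT (wave-1 audit,
  2026-08-17: no instance of `Motives.CorrespondenceChowAction` is constructible in the tree — the
  intersection product of Fulton Ch. 6–8 is absent; the cohomological half is constructible relative to
  a `GysinFormalism` via `GysinFormalism.correspondenceAction`);
* F2 `HodgeIsolatingCorrespondence` (HP) — a cycle `Z` with `[Z]^* c = m·c` killing every `(q,0)`-class;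
  OPEN off the endomorphism sectors (for the intended actions it is the Hodge conjecture for `X × X` in
  codimension `2p`; theorem on CM / Weil-type abelian varieties, where `Z` is a `ℤ`-combination of
  graphs of complex multiplications — the line's Weil sector);
* F3 `GeneralizedBlochNilpotence` (GB₀) — such a `Z` acts nilpotently on point classes up to one
  integer; OPEN (Voisin II Conj. 11.22 for self-correspondences, converse of Prop. 10.24; Kimura 2005
  Prop. 7.5 in the finite-dimensional sector).

THE LEVER (reverse Bloch–Srinivas, proved here): `W = Z^{∘N}` (K2) is CH₀-null up to `M`, so
Bloch–Srinivas (K1, Voisin II Cor. 10.20, tree fact `Motives.BlochSrinivas1983_correspondence_nullOnPoints`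
for the package's own `Act`) and Voisin II (10.8) (tree `CorrespondenceAction.act_mem_supportedClasses`)
put `[W]^* c = m^N c` in `N¹H^{2p} = supportedClasses X (2p) 1`; divide by `M m^N`.

Main results: `act_mem_supportedClasses_of_nsmul_null` (a cycle killing a fixed multiple of every
point class acts into `N¹`), `middleDivisorSupport_of_frame` (registered sub-goal of
stmt-HodgeConjecture-1081; `F1 → F2 → F3 →` the crux decl of route LinearSystemTorelli) and
`nodalSupport_middleDivisorSupport_of_frame` (the same for the definitionally equal `NodalSupport`
copy of the shared item). No definition, no new named fact; the three hypotheses are the route Defs.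

## References

* [VoisinHodgeII2003] C. Voisin, Hodge Theory and Complex Algebraic Geometry II, Cor. 10.20, proof of
  Thm. 10.17 (10.7)–(10.8), Prop. 10.24, Conj. 11.22.
* [Fulton1998] W. Fulton, Intersection Theory, Def. 16.1.2, Prop. 16.1.1 (a), Prop. 16.1.2 (c).
* [BlochSrinivas1983] S. Bloch, V. Srinivas, Remarks on correspondences and algebraic cycles, Prop. 1.
-/

noncomputable section

-- `Summit.HodgeConjecture.HodgeConjecture.Theorems` is the mandated namespace (single-problem summit:
-- Problem = Summit), which `linter.dupNamespace` flags on every declaration; the lakefile turns the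
-- linter off tree-wide (weak option), restated here so stand-alone elaboration is warning-free too.
set_option linter.dupNamespace false

namespace Summit.HodgeConjecture.HodgeConjecture.Theorems.Ch0Null

open CategoryTheory AlgebraicGeometry MonoidalCategory
open Literature.AlgebraicGeometry Literature.AlgebraicGeometry.HodgeTheory
open Literature.AlgebraicGeometry.Motives
open Literature.AlgebraicTopology.SingularHomology
open scoped BigOperators

/-! ### Glue lemmas -/

/-- Dividing out a positive integer in a `ℂ`-subspace: `k • c ∈ S`, `k ≥ 1` ⟹ `c ∈ S`. [folklore] -/
theorem mem_of_nsmul_mem {V : Type*} [AddCommGroup V] [Module ℂ V] (S : Submodule ℂ V) {k : ℕ}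
    (hk : 0 < k) {c : V} (h : k • c ∈ S) : c ∈ S := by
  have hk' : (k : ℂ) ≠ 0 := Nat.cast_ne_zero.2 hk.ne'
  have h' : (k : ℂ) • c ∈ S := by rwa [Nat.cast_smul_eq_nsmul]
  have := S.smul_mem ((k : ℂ)⁻¹) h'
  rwa [inv_smul_smul₀ hk'] at this

/-- Iterating an endomorphism on an eigenvector with natural eigenvalue `m`: `L^[N] c = m^N • c`.
[folklore] -/
theorem iterate_apply_of_apply_eq_nsmul {V : Type*} [AddCommGroup V] [Module ℂ V]
    (L : V →ₗ[ℂ] V) {c : V} {m : ℕ} (h : L c = m • c) (N : ℕ) : L^[N] c = m ^ N • c := by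
  induction N with
  | zero => simp
  | succ N ih =>
    rw [Function.iterate_succ_apply', ih, map_nsmul, h, smul_smul, pow_succ]

/-- A closed point of a scheme locally of finite type over `ℂ` underlies a complex point
(`AlgPoints.exists_pt_eq_of_isClosed_singleton`). [folklore] -/
theorem exists_pt_eq_of_primeCycle_mem {X : SchemeOver ℂ} [LocallyOfFiniteType X.hom] {x : X.left}
    (hx : primeCycle x ∈ cyclesOfDim X.left 0) : ∃ P : ComplexPoints X, P.pt = x := by
  have h0 : Order.height x = 0 := hx x (by simp)
  exact AlgPoints.exists_pt_eq_of_isClosed_singleton (isClosed_singleton_of_height_eq_zero h0)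

/-- **On a correspondence package, a cycle whose Chow action kills a fixed positive multiple of
every POINT CLASS has cohomological action supported in codimension `≥ 1`**: Voisin II (10.8) with
Cor. 10.20 — the package's (K1) `BlochSrinivas1983_correspondence_nullOnPoints` for its own `Act`,
through the tree's `corrAct_mem_supportedClasses`, after passing from closed points to complex points
and from `M • Z_*{x} = 0` to `(M • Z)_*{x} = 0`. [cite: VoisinHodgeII2003, Cor. 10.20 and proof of Thm. 10.17 (10.8)] -/
theorem act_mem_supportedClasses_of_nsmul_null {p : ℕ} {X : SchemeOver ℂ}
    (hX : IsSmoothProjective (2 * p) X) {Act : CorrespondenceChowAction (2 * p) X X}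
    {C : CorrespondenceAction (2 * p) X} (hP : IsCorrespondencePackage p X Act C)
    (Z : ↥(cyclesOfDim (X ⊗ X).left (2 * p))) {M : ℕ} (hM : 0 < M)
    (hnull : ∀ P : ComplexPoints X, M • chowAct Act Z (pointClass X P) = 0)
    (r : ℕ) (β : complexBetti X r) : C.act r Z β ∈ supportedClasses X r 1 := by
  haveI : LocallyOfFiniteType X.hom := locallyOfFiniteType_of_isSmoothProjective hX
  have hnull' : ∀ (x : X.left) (hx : primeCycle x ∈ cyclesOfDim X.left 0),
      Act.act (2 * p) 0 0 rfl (ChowGroup.mk (X ⊗ X).left (2 * p) (M • Z))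
        (ChowGroup.mk X.left 0 ⟨primeCycle x, hx⟩) = 0 := by
    intro x hx
    obtain ⟨P, rfl⟩ := exists_pt_eq_of_primeCycle_mem hx
    rw [map_nsmul, map_nsmul, AddMonoidHom.nsmul_apply]
    exact hnull P
  have hmem := BlochSrinivas1983_correspondence_nullOnPoints.corrAct_mem_supportedClasses
    hP.blochSrinivas hX (M • Z) hnull' C r β
  rw [C.act_nsmul, LinearMap.smul_apply] at hmem
  exact mem_of_nsmul_mem _ hM hmem

/-! ### The frame composition, BY NAME -/

/-- **THE ∀X ATTACH FRAME: F1 → F2 → F3 → `MiddleDivisorSupport`, BY NAME.** Given a rational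
`(p,p)` class `c` on a smooth projective `X^{2p}`: take the package `(Act, C)` (F1), a Hodge-isolating
cycle `Z` with `[Z]^* c = m c`, `m ≥ 1`, killing all `(q,0)`-classes (F2), the nilpotence
`M · (Z_*)^N {P} = 0` (F3), and the power cycle `W = Z^{∘N}` (K2): `W` kills `M · {P}` for every complex
point, so `[W]^* c = ([Z]^*)^N c = m^N c` lies in `N¹H^{2p}` (`act_mem_supportedClasses_of_nsmul_null`),
hence so does `c`. Conditional on three route-posited statements (F1 construction debt, F2/F3 open —
module docstring); registered sub-goal `middleDivisorSupport_of_frame` of stmt-HodgeConjecture-1081.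
[cite: VoisinHodgeII2003, Cor. 10.20, (10.8) and Conj. 11.22] -/
theorem middleDivisorSupport_of_frame : CorrespondencePackagesExist → HodgeIsolatingCorrespondence → GeneralizedBlochNilpotence → Summit.HodgeConjecture.HodgeConjecture.Theses.LinearSystemTorelli.MiddleDivisorSupport := by
  intro h₁ h₂ h₃ p X hp hX c hc hH
  obtain ⟨Act, C, hP⟩ := h₁ hp hX
  obtain ⟨Z, m, hm, hfix, hkill⟩ := h₂ hp hX Act C hP c hc hH
  obtain ⟨N, M, hN, hM, hnil⟩ := h₃ hp hX Act C hP Z hkill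
  obtain ⟨W, hWC, hWA⟩ := hP.powers Z N hN
  have hWnull : ∀ P : ComplexPoints X, M • chowAct Act W (pointClass X P) = 0 := by
    intro P
    rw [hWA P]
    exact hnil P
  have hmem := act_mem_supportedClasses_of_nsmul_null hX hP W hM hWnull (2 * p) c
  rw [hWC (2 * p), Module.End.pow_apply, iterate_apply_of_apply_eq_nsmul _ hfix] at hmem
  exact mem_of_nsmul_mem _ (pow_pos hm N) hmem

/-- **The same frame against the `NodalSupport` copy of the shared crux decl** (stmt-HodgeConjecture-1081
is ONE ledger item wanted, with the identical statement, by routes `NodalSupport` and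
`LinearSystemTorelli`; the two decls are definitionally equal).
[cite: VoisinHodgeII2003, Cor. 10.20, (10.8) and Conj. 11.22] -/
theorem nodalSupport_middleDivisorSupport_of_frame (h₁ : CorrespondencePackagesExist)
    (h₂ : HodgeIsolatingCorrespondence) (h₃ : GeneralizedBlochNilpotence) :
    Summit.HodgeConjecture.HodgeConjecture.Theses.NodalSupport.MiddleDivisorSupport :=
  fun _ _ hp hX c hc hH => middleDivisorSupport_of_frame h₁ h₂ h₃ hp hX c hc hH

end Summit.HodgeConjecture.HodgeConjecture.Theorems.Ch0Null

end
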